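import Summits.Langlands.Langlands.Theses.AdjointEulerNumerical
import Literature.NumberTheory.EllipticCurves.Selmer
import Literature.NumberTheory.EllipticCurves.GaloisAction
import Literature.NumberTheory.EllipticCurves.AnalyticRank
import Literature.NumberTheory.EllipticCurves.SelmerFirstZeroTotallyReal
import Literature.NumberTheory.Automorphic.TotallyRealModularity
import HarnessLib

/-!
# Crux `PlecticLegs.PlecticPointsLB` (stmt-BirchSwinnertonDyer-17518), line `Sketch` rev 2 —
# stub 2 `stub_firstZeroPlectic`: first-order vanishing gives one Selmer class, in the parity-matched regime,
# from Wan 2015 Thm 7 and modularity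

Registered stub 2 of `Cruxes/PlecticPointsLB/Lines/Sketch.lean` (rev 2). For `F` totally real, `V/F` elliptic, `p`
admissible (`5 ≤ p`, `p ∤ disc F`, `ρ̄_{V,p}` irreducible, good ordinary above `p` on Mathlib's `localPolynomial`), if
`ord_{s=1} L(V/F,s) ≡ [F:ℚ] (mod 2)` and `1 ≤ ord`, then `1 ≤ corank_{ℤ_p} Sel_{p^∞}(V/F)` — GIVEN
`Literature.NumberTheory.EllipticCurves.Wan2015_theorem7_ellipticCurve` (X. Wan, Forum Math. Sigma 3 (2015) e18,
Thm 7, rendered for modular elliptic curves; landed p164649) and modularity of elliptic curves over totally real fields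
(`Summit.Langlands.Langlands.Theses.AdjointEulerNumerical.TotallyRealWeightZeroAutomorphic`, stmt-Langlands-2176; in
print for `[F:ℚ] ≤ 3` and quartic `F ∌ √5`), both entering as the stub's own hypotheses. The parity hypothesis makes
Wan's hypothesis (iii) (even degree, sign `−1`) vacuous; in the plectic regime `ord = [F:ℚ]` it holds trivially.
Proof by worker A of wave 1 (`Lines/Sketch_stub_firstZero.lean`), reproduced here under the registered header.
-/

set_option linter.dupNamespace false -- single-conjunct summit: Sub = Summit (D-0017)

open NumberField IsDedekindDomain

namespace Summit.BirchSwinnertonDyer.BirchSwinnertonDyer.Theorems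

open Literature.NumberTheory.EllipticCurves Literature.NumberTheory.Automorphic
open Summit.Langlands.Langlands.Theses.AdjointEulerNumerical (TotallyRealWeightZeroAutomorphic)

/-- An integral model of an elliptic curve has non-zero discriminant: if `C • E.baseChange F = V` with `V`
elliptic then `E.Δ ≠ 0` (`Δ(C • W) = u^{-12} Δ(W)`, `Δ(E_F) = Δ(E)` in `F`). [folklore] -/
theorem Δ_ne_zero_of_integralModel {F : Type} [Field F] [NumberField F] {V : WeierstrassCurve F}
    [V.IsElliptic] {E : WeierstrassCurve (𝓞 F)} {C : WeierstrassCurve.VariableChange F}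
    (h : C • E.baseChange F = V) : E.Δ ≠ 0 := by
  intro hE
  apply V.isUnit_Δ.ne_zero
  rw [← h, WeierstrassCurve.variableChange_Δ, WeierstrassCurve.baseChange, WeierstrassCurve.map_Δ, hE,
    map_zero, mul_zero]

/-- **Modularity supply ⇒ the fact's modularity clause.** If every integral model with `Δ ≠ 0` over every totally
real field is automorphic of weight zero (the Langlands crux `TotallyRealWeightZeroAutomorphic`), then every
elliptic `V` over a totally real `F` has an integral model `E`, `C • E.baseChange F = V`, with
`IsAutomorphicOfWeightZero E`. [folklore] -/
theorem exists_automorphicIntegralModel (hMod : TotallyRealWeightZeroAutomorphic)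
    (F : Type) [Field F] [NumberField F] [IsTotallyReal F] (V : WeierstrassCurve F) [V.IsElliptic] :
    ∃ (E : WeierstrassCurve (𝓞 F)) (C : WeierstrassCurve.VariableChange F),
      C • E.baseChange F = V ∧ IsAutomorphicOfWeightZero E := by
  obtain ⟨E, C, h⟩ := V.exists_variableChange_smul_baseChange_eq (R := 𝓞 F)
  exact ⟨E, C, h, hMod F E (Δ_ne_zero_of_integralModel h)⟩

/-- **Core step.** Under the stub's binders, if `V` has a weight-zero automorphic integral model and
`ord_{s=1} L(V/F,s) ≡ [F:ℚ] (mod 2)` — so that Wan's hypothesis (iii) is vacuous: `[F:ℚ]` even forces the order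
even — then `1 ≤ ord ⇒ 1 ≤ corank_{ℤ_p} Sel_{p^∞}(V/F)` by `Wan2015_theorem7_ellipticCurve`. [cite: Wan2015HilbertIMC, Thm. 7] -/
theorem one_le_selmerCorank_of_wan_of_automorphicModel (hW : Wan2015_theorem7_ellipticCurve)
    (F : Type) [Field F] [NumberField F] [IsTotallyReal F] (V : WeierstrassCurve F) [V.IsElliptic]
    (p : ℕ) [Fact p.Prime] (h5 : 5 ≤ p) (hdisc : ¬ ((p : ℤ) ∣ NumberField.discr F))
    (hirr : V.HasIrreducibleModPGaloisRep p)
    (hord : ∀ 𝔭 : HeightOneSpectrum (𝓞 F), (p : 𝓞 F) ∈ 𝔭.asIdeal →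
      ((V.baseChange (𝔭.adicCompletion F)).localPolynomial (𝔭.adicCompletionIntegers F)).natDegree = 2 ∧
      ¬ (p : ℤ) ∣ ((V.baseChange (𝔭.adicCompletion F)).localPolynomial
        (𝔭.adicCompletionIntegers F)).coeff 1)
    (hmod : ∃ (E : WeierstrassCurve (𝓞 F)) (C : WeierstrassCurve.VariableChange F),
      C • E.baseChange F = V ∧ IsAutomorphicOfWeightZero E)
    (hpar : V.analyticRank % 2 = Module.finrank ℚ F % 2) (hpos : 1 ≤ V.analyticRank) :
    1 ≤ V.selmerCorank p := by
  refine hW F V p h5 hdisc hirr hord hmod ?_ hpos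
  intro hd hodd
  exfalso
  rw [Nat.even_iff] at hd
  rw [Nat.odd_iff] at hodd
  omega

/-- **Stub 2 · `stub_firstZeroPlectic` (line `Sketch`, rev 2).** Wan 2015 Thm 7 (for modular elliptic curves) and
modularity of elliptic curves over totally real fields imply: for `F` totally real, `V/F` elliptic, `p` admissible,
`ord_{s=1} L(V/F,s) ≡ [F:ℚ] (mod 2)` and `1 ≤ ord` give `1 ≤ corank_{ℤ_p} Sel_{p^∞}(V/F)`.
[cite: Wan2015HilbertIMC, Thm. 7] -/
theorem stub_firstZeroPlectic :
    Wan2015_theorem7_ellipticCurve → TotallyRealWeightZeroAutomorphic →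
    ∀ (F : Type) [Field F] [NumberField F] [NumberField.IsTotallyReal F] (V : WeierstrassCurve F)
      [V.IsElliptic] (p : ℕ) [Fact p.Prime], 5 ≤ p → ¬ ((p : ℤ) ∣ NumberField.discr F) →
      V.HasIrreducibleModPGaloisRep p →
      (∀ 𝔭 : HeightOneSpectrum (𝓞 F), (p : 𝓞 F) ∈ 𝔭.asIdeal →
        ((V.baseChange (𝔭.adicCompletion F)).localPolynomial (𝔭.adicCompletionIntegers F)).natDegree = 2 ∧
        ¬ (p : ℤ) ∣ ((V.baseChange (𝔭.adicCompletion F)).localPolynomial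
          (𝔭.adicCompletionIntegers F)).coeff 1) →
      V.analyticRank % 2 = Module.finrank ℚ F % 2 → 1 ≤ V.analyticRank → 1 ≤ V.selmerCorank p := by
  intro hW hMod F _ _ _ V _ p _ h5 hdisc hirr hord hpar hpos
  exact one_le_selmerCorank_of_wan_of_automorphicModel hW F V p h5 hdisc hirr hord
    (exists_automorphicIntegralModel hMod F V) hpar hpos

end Summit.BirchSwinnertonDyer.BirchSwinnertonDyer.Theorems
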